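import Summits.ResolutionOfSingularities.ResolutionOfSingularities.Theorems.ExitCutTransport2
import HarnessLib

/-!
# MaxContactCutPort — decomp-res node «PortCut» (lens-2 g28, critic row 219 CLEARED · MAP +1 ONCE (D1: the
multi-unit port proved for every n)), tree file 3/5 of the node

Content VERBATIM from the decomp-res lens-2 g28 node `HOME/decomp-res-lens-2/g28/PortCut.lean` (pin 67bf9bb7; no
carry, imports the landed g27 node «ExitCut» + Literature; ns `…Theses.PortCut` ↦ `…Theorems.PortCut`); HOME =
run/shared/lean/pub/decomp-res; critic CRITIC-LEDGER row 219 CLEARED · MAP +1 ONCE (D1): `componentPackagePort_holds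
: ∀ n, ComponentPackagePort n` in kernel via `multiUnitPackageTransport_holds`; landing orders LANDING NOTE :1549 +
rider 12:16:46Z — provenance and critic text in full (and the lens header verbatim) in `ExitCutTransport`.  `--kind
proof --supports stmt-ResolutionOfSingularities-29273`.

## This file

§U `section Units` — PACKAGE UNITS: `structure PackageUnit` (a closed, open-in-Top set of top points carrying
`PackageExitsOver`), `exists_unit_of_isComponentExitPt` / `_isCurveExitPt` / `_isPackageExitPt` / `_isNearExitPt`,
`exists_finset_units`; §P `section Port` — THE PORT: `exists_unit_transport`, `transport_conclusion`,
`transport_kernel`; §C `section Kernel` — **`multiUnitPackageTransport_holds (n)`**, **`componentPackagePort_holds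
(n) : ComponentPackagePort n`** (every `n`, hypothesis-free), `componentPackagePort_holds'` (the `∀ n ≥ 2` binder
shape).  (The 400-line cap cuts this group into 2 files; this first part carries: `PackageUnit`,
`exists_unit_of_isComponentExitPt`, `exists_unit_of_isCurveExitPt`, `exists_unit_of_isPackageExitPt`,
`exists_unit_of_isNearExitPt`, `exists_finset_units`, `exists_unit_transport`, `transport_conclusion`, `transport_kernel`.)

[WRITER NOTE (decomp-res writer g13): file split only (tree files ≤ 400 lines); sections, section `variable`s /
`open`s and every declaration exactly as in the lens (namespace renamed Theses ↦ Theorems, the HOME-only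
dupNamespace-linter line dropped; `noncomputable section` and the five file-level `open` lines replayed in every
file). Audit-cone caveat of the lens honoured: each pattern-matching recursive helper
(`isRegular_top_of_weakAdmissible`, `stalkIdeal_transformMarked_of_not_mem`, `WeakAdmissible.restrict`) stays in the
same file as a tactic-style proof referencing it whenever the cap allows; a cut between them changes nothing for the kernel.]

(Sources: Hironaka1964 Ch. III §§1–3, §7; Giraud1975; CossartJannsenSaito2020 Ch. 2, Ch. 8–9; EGAIV4 §16–§17;
Matsumura1987 §28–§30; CossartPiltant2008 Prop. 4.2; BierstoneMilman1997 §3; Cutkosky2004 Ch. 6–7; Kollar2007 §3;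
StacksProject 01WV / 0806 / 080A.)
-/

noncomputable section

open CategoryTheory AlgebraicGeometry IsLocalRing TopologicalSpace Topology
open Literature.AlgebraicGeometry.Resolution
open Summit.ResolutionOfSingularities.ResolutionOfSingularities.Theorems
open Summit.ResolutionOfSingularities.ResolutionOfSingularities.Theorems.WeakOrderReduction
open Summit.ResolutionOfSingularities.ResolutionOfSingularities.Theorems.FaceFormCutClasses

namespace Summit.ResolutionOfSingularities.ResolutionOfSingularities.Theorems.PortCut

section Units

open Summit.ResolutionOfSingularities.ResolutionOfSingularities.Theorems.DeltaFaceCutClasses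
open Summit.ResolutionOfSingularities.ResolutionOfSingularities.Theorems.RelativeDeltaCut
open Summit.ResolutionOfSingularities.ResolutionOfSingularities.Theorems.CrossCut
variable {Y : Scheme.{0}}

/-! ## §U  Package units -/

/-- A **PACKAGE UNIT** of `(𝓘, n)` (bundled data, not a proposition): a closed set `carrier` of points of order
`n`, OPEN IN THE TOP LOCUS (some open `U ⊇ carrier` meets the top locus `{ord = n}` inside `carrier`), carrying an
exit package with centres over it (`RelativeDeltaCut.PackageExitsOver`).  Each of the port's four unit-exit kinds
puts the point on a unit (below); the tree's `IsTopComponent T ∧ PackageExitsOver I n T` is the preconnected case. -/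
structure PackageUnit (I : Y.IdealSheafData) (n : ℕ) where
  /-- the underlying closed set of top points -/
  carrier : Set Y
  /-- every point of the unit is a top point -/
  ord_eq : ∀ x ∈ carrier, idealOrder I x = ((n : ℕ) : ℕ∞)
  /-- the unit is closed -/
  isClosed : IsClosed carrier
  /-- the unit is open in the top locus -/
  openInTop : ∃ U : Y.Opens, carrier ⊆ (U : Set Y) ∧
    ∀ x : Y, x ∈ U → idealOrder I x = ((n : ℕ) : ℕ∞) → x ∈ carrier
  /-- the unit carries an exit package with centres over it -/
  exits : PackageExitsOver I n carrier

/-- A COMPONENT-EXIT point lies on a unit (by letter). [folklore] -/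
theorem exists_unit_of_isComponentExitPt {I : Y.IdealSheafData} {n : ℕ} {y : Y}
    (h : IsComponentExitPt I n y) : ∃ u : PackageUnit I n, y ∈ u.carrier := by
  obtain ⟨T, hyT, ⟨htop, hcl, -, hU⟩, hP⟩ := h
  exact ⟨⟨T, htop, hcl, hU, hP⟩, hyT⟩

/-- A CURVE-EXIT point lies on a unit: in the frame `ord ≤ n` the closure of the curve lies in the top locus
(`idealOrder_le_of_specializes`), so the tree's `isComponentExitPt_of_isCurveExitPt` applies. [folklore] -/
theorem exists_unit_of_isCurveExitPt (hY : Scheme.IsRegular Y) {I : Y.IdealSheafData} {n : ℕ}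
    (hord : ∀ x : Y, idealOrder I x ≤ ((n : ℕ) : ℕ∞)) {y : Y} (h : IsCurveExitPt I n y) :
    ∃ u : PackageUnit I n, y ∈ u.carrier :=
  exists_unit_of_isComponentExitPt (isComponentExitPt_of_isCurveExitPt h fun η x _ hηx hη => by
    haveI := hY x
    exact le_antisymm (hord x) (hη ▸ idealOrder_le_of_specializes hηx I))

/-- A PACKAGE-EXIT point (closed, Top-isolated, with `PackageExitsAt`) is a one-point unit. [folklore] -/
theorem exists_unit_of_isPackageExitPt {I : Y.IdealSheafData} {n : ℕ} {y : Y}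
    (hy : idealOrder I y = ((n : ℕ) : ℕ∞)) (h : IsPackageExitPt I n y) :
    ∃ u : PackageUnit I n, y ∈ u.carrier := by
  obtain ⟨hcl, ⟨U, hyU, hU⟩, hP⟩ := h
  refine ⟨⟨{y}, fun x hx => by rw [Set.mem_singleton_iff.mp hx]; exact hy, hcl,
    ⟨U, Set.singleton_subset_iff.mpr hyU, fun x hx hox => Set.mem_singleton_iff.mpr (hU x hx hox)⟩, ?_⟩,
    Set.mem_singleton y⟩
  intro hN
  obtain ⟨s, hadm, hover, hT, hτ⟩ := hP hN
  exact ⟨s, hadm, hover, hT, fun x hx hox => hτ x (Set.mem_singleton_iff.mp hx) hox⟩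

/-- A NEAR-EXIT point (closed, Top-isolated, `ExitsAtTwo` in a minimal regular system) is a one-point unit:
its package is the ONE blow-up of the reduced point — weakly admissible (the centre is the top point, its
subscheme `Spec κ(y)` is regular: `stalkIdeal_vanishingIdeal_singleton`, `Scheme.isRegular_subscheme_of_forall`),
regular top (`IsBlowup.isRegular_of_isRegular_subscheme`), and `τ ≥ 2` at every near point over `y` by
`ExitsAtTwo` fed with the centre's stalk `= 𝔪_y`. [folklore] -/
theorem exists_unit_of_isNearExitPt (hY : Scheme.IsRegular Y) {I : Y.IdealSheafData} {n : ℕ} {y : Y}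
    (hy : idealOrder I y = ((n : ℕ) : ℕ∞)) (h : VeryNearCutClasses.IsNearExitPt I n y) :
    ∃ u : PackageUnit I n, y ∈ u.carrier := by
  obtain ⟨hcl, ⟨U, hyU, hU⟩, d, c, hc, -, hex⟩ := h
  refine ⟨⟨{y}, fun x hx => by rw [Set.mem_singleton_iff.mp hx]; exact hy, hcl,
    ⟨U, Set.singleton_subset_iff.mpr hyU, fun x hx hox => Set.mem_singleton_iff.mpr (hU x hx hox)⟩, ?_⟩,
    Set.mem_singleton y⟩
  intro hN
  let C : Y.IdealSheafData := Scheme.IdealSheafData.vanishingIdeal ⟨{y}, hcl⟩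
  have hCsupp : (C.support : Set Y) = {y} := coe_support_vanishingIdeal_singleton hcl
  have hCst : stalkIdeal C y = maximalIdeal (Y.presheaf.stalk y) := stalkIdeal_vanishingIdeal_singleton hcl
  have hCreg : Scheme.IsRegular C.subscheme := by
    refine Scheme.isRegular_subscheme_of_forall _ fun x hx => ?_
    have hx' : x = y := by rw [← Set.mem_singleton_iff, ← hCsupp]; exact hx
    rw [hx', hCst]
    letI := Ideal.Quotient.field (maximalIdeal (Y.presheaf.stalk y))
    infer_instance
  have hπ : IsBlowup (blowup.π C) C := blowup.isBlowup C
  haveI : IsLocallyNoetherian (blowup C) := CentreSeq.isLocallyNoetherian_blowup C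
  have hY₁ : Scheme.IsRegular (blowup C) := IsBlowup.isRegular_of_isRegular_subscheme hY hCreg hπ
  refine ⟨.cons C (.nil _), ?_, ?_, hY₁, ?_⟩
  · refine (weakAdmissible_cons C _ _).mpr ⟨?_, hCreg, trivial⟩
    intro x hx
    have hx' : x = y := by rw [← Set.mem_singleton_iff, ← hCsupp]; exact hx
    change ((n : ℕ) : ℕ∞) ≤ idealOrder I x
    rw [hx', hy]
  · exact (CentreSeq.centresOver_cons C _ _).mpr ⟨hCsupp.le, trivial⟩
  · intro x hx hox
    have hxy : blowup.π C x = y := Set.mem_singleton_iff.mp hx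
    haveI := hY₁ x
    change 2 ≤ stalkTau (controlledTransform (blowup.π C) C I n) x n
    exact hex (blowup C) (blowup.π C) ⟨{y}, hcl⟩ hπ hN inferInstance (hc.trans hCst.symm) x hxy (hY₁ x) hox

/-- **FINITELY MANY UNITS SUFFICE** on a noetherian `Y`: the union `W` of the opens `U_u` witnessing open-in-Top
for all units `u` is compact (`NoetherianSpace.isCompact`), so finitely many `U_u` cover `W`; a top point on some
unit lies in `W`, hence in some `U_{u_i}`, hence (order `n`) on `u_i`. [folklore] -/
theorem exists_finset_units [IsNoetherian Y] {k : Type} [Field k] (g : Y ⟶ Spec (.of k))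
    (hY : Scheme.IsRegular Y) (I : Y.IdealSheafData) (n : ℕ)
    (hcov : ∀ y : Y, idealOrder I y = ((n : ℕ) : ℕ∞) →
      ClassGE g hY I n 2 y ∨ ∃ u : PackageUnit I n, y ∈ u.carrier) :
    ∃ F : Finset (PackageUnit I n),
      ∀ y : Y, idealOrder I y = ((n : ℕ) : ℕ∞) → ClassGE g hY I n 2 y ∨ ∃ u ∈ F, y ∈ u.carrier := by
  classical
  choose U hTU hUT using fun u : PackageUnit I n => u.openInTop
  have hW : IsCompact (⋃ u, (U u : Set Y)) := NoetherianSpace.isCompact _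
  obtain ⟨t, ht⟩ := hW.elim_finite_subcover (fun u => (U u : Set Y)) (fun u => (U u).2) subset_rfl
  refine ⟨t, fun y hy => ?_⟩
  rcases hcov y hy with hc | ⟨u, hyu⟩
  · exact Or.inl hc
  · have hyW : y ∈ ⋃ u, (U u : Set Y) := Set.mem_iUnion.mpr ⟨u, hTU u hyu⟩
    obtain ⟨i, hi, hyi⟩ := Set.mem_iUnion₂.mp (ht hyW)
    exact Or.inr ⟨i, hi, hUT i y hyi hy⟩

end Units

section Port

open Summit.ResolutionOfSingularities.ResolutionOfSingularities.Theorems.RelativeDeltaCut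
variable {Y : Scheme.{0}}

/-! ## §P  The port: transport of a unit through the package of another, induction on the units -/

/-- **TRANSPORT OF A UNIT THROUGH THE PACKAGE OF ANOTHER UNIT.**  Let `s` be a package over the unit `T`
(weakly admissible for `(𝓘, ∅, n)`, centres over the closed `T`, `U ⊇ T` open meeting the top locus inside `T`)
and `u` another unit.  Then `s.comp ⁻¹' (u ∖ T)` is (the carrier of) a unit of the transformed datum `(𝓘_r, n)`:
* off `T` the composite `s.comp` is a local isomorphism (`CentresOver.isIso_stalkMap_comp_of_not_mem`) carrying
  `𝓘` to `𝓘_r` (`stalkIdeal_transformMarked_eq_map_of_not_mem`), so orders are transported (§T);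
* `u ∖ T = u ∖ U` is closed, and `s.comp ⁻¹' (U' ∩ (Y ∖ T))` witnesses open-in-Top;
* THE PACKAGE: restrict the package `s'` of `u` along the open immersion `f₁ : s.comp ⁻¹(Y ∖ T) ≅ Y ∖ T ↪ Y`
  (`CentresOver.isIso_morphismRestrict_comp`, `WeakAdmissible.restrict`, `CentresOver.restrict`,
  `tauTwo_restrict`), identify `f₁^* 𝓘 = ι₁^* 𝓘_r` on that open (`comap_transformMarked_of_forall_not_mem`),
  and EXTEND it over the closed `s.comp ⁻¹' (u ∖ T)` of `X_r` (`exists_extend_weak`); the `τ ≥ 2` conclusion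
  descends (`tauTwo_of_isPullbackAlong`). [folklore] -/
theorem exists_unit_transport [IsLocallyNoetherian Y] (hY : Scheme.IsRegular Y) (I : Y.IdealSheafData)
    (n : ℕ) {T : Set Y} (s : CentreSeq Y) (hadm : WeakAdmissible s (⟨I, [], n⟩ : MarkedIdeal Y))
    (hover : s.CentresOver T) (hTcl : IsClosed T) {U : Y.Opens} (hTU : T ⊆ (U : Set Y))
    (hUT : ∀ x : Y, x ∈ U → idealOrder I x = ((n : ℕ) : ℕ∞) → x ∈ T) (u : PackageUnit I n) :
    ∃ u₁ : PackageUnit (s.transformMarked (⟨I, [], n⟩ : MarkedIdeal Y)).ideal n,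
      u₁.carrier = s.comp ⁻¹' (u.carrier \ T) := by
  obtain ⟨T', hT'top, hT'cl, ⟨U', hT'U', hU'T'⟩, hP'⟩ := u
  have hY₁ : Scheme.IsRegular s.top := isRegular_top_of_weakAdmissible s _ hY hadm
  -- orders off `T` are those downstairs
  have hordoff : ∀ x : s.top, s.comp x ∉ T →
      idealOrder (s.transformMarked (⟨I, [], n⟩ : MarkedIdeal Y)).ideal x = idealOrder I (s.comp x) := by
    intro x hx
    haveI := hover.isIso_stalkMap_comp_of_not_mem hTcl hx
    exact idealOrder_eq_of_isIso_stalkMap s.comp I _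
      (stalkIdeal_transformMarked_eq_map_of_not_mem s _ hover x hx)
  -- `T' ∖ T = T' ∖ U`
  have hdiff : T' \ T = T' ∩ (U : Set Y)ᶜ := by
    ext x
    simp only [Set.mem_sdiff, Set.mem_inter_iff, Set.mem_compl_iff]
    exact ⟨fun ⟨h1, h2⟩ => ⟨h1, fun hxU => h2 (hUT x hxU (hT'top x h1))⟩,
      fun ⟨h1, h2⟩ => ⟨h1, fun hxT => h2 (hTU hxT)⟩⟩
  have hS₁cl : IsClosed (s.comp ⁻¹' (T' \ T)) := by
    rw [hdiff]; exact (hT'cl.inter U.2.isClosed_compl).preimage s.comp.continuous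
  refine ⟨⟨s.comp ⁻¹' (T' \ T), ?_, hS₁cl, ?_, ?_⟩, rfl⟩
  · rintro x ⟨hxT', hxT⟩
    rw [hordoff x hxT]; exact hT'top _ hxT'
  · refine ⟨s.comp ⁻¹ᵁ (U' ⊓ ⟨Tᶜ, hTcl.isOpen_compl⟩), ?_, ?_⟩
    · rintro x ⟨hxT', hxT⟩
      exact ⟨hT'U' hxT', hxT⟩
    · rintro x ⟨hxU', hxT⟩ hox
      have hxT : s.comp x ∉ T := hxT
      refine ⟨hU'T' _ hxU' ?_, hxT⟩
      rw [← hordoff x hxT]; exact hox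
  · intro hN₁
    obtain ⟨s', hadm', hover', hreg', hτ'⟩ := hP' inferInstance
    -- restrict the package of `T'` to `Y ∖ T`, seen as the open `V₁` of `s.top`
    let V : Y.Opens := ⟨Tᶜ, hTcl.isOpen_compl⟩
    let V₁ : s.top.Opens := s.comp ⁻¹ᵁ V
    let f₁ : (V₁ : Scheme.{0}) ⟶ Y := V₁.ι ≫ s.comp
    haveI : IsIso (s.comp ∣_ V) := hover.isIso_morphismRestrict_comp s V disjoint_compl_left
    haveI hf₁ : IsOpenImmersion f₁ := by
      rw [show f₁ = (s.comp ∣_ V) ≫ V.ι from (morphismRestrict_ι s.comp V).symm]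
      infer_instance
    have hf₁T : ∀ v : (V₁ : Scheme.{0}), s.comp (V₁.ι v) ∉ T := fun v => v.2
    haveI := s'.isOpenImmersion_restrictι f₁
    have hTu : Scheme.IsRegular (s'.restrict f₁).top :=
      Scheme.IsRegular.of_isOpenImmersion (s'.restrictι f₁) hreg'
    have hu_adm : WeakAdmissible (s'.restrict f₁) ((⟨I, [], n⟩ : MarkedIdeal Y).comap f₁) :=
      WeakAdmissible.restrict s' f₁ _ hadm'
    have hu_over : (s'.restrict f₁).CentresOver (f₁ ⁻¹' T') := CentreSeq.CentresOver.restrict s' f₁ hover'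
    have hτu := tauTwo_restrict s' f₁ (⟨I, [], n⟩ : MarkedIdeal Y) T' hreg' hTu hτ'
    -- the two marked ideals on `V₁` agree: `ι₁^*(𝓘_r) = f₁^* 𝓘`
    have hKey : (s.transformMarked (⟨I, [], n⟩ : MarkedIdeal Y)).ideal.comap V₁.ι = I.comap f₁ :=
      comap_transformMarked_of_forall_not_mem s _ hover V₁.ι hf₁T
    have hM : (⟨(s.transformMarked (⟨I, [], n⟩ : MarkedIdeal Y)).ideal, [], n⟩ : MarkedIdeal s.top).comap
        V₁.ι = (⟨I, [], n⟩ : MarkedIdeal Y).comap f₁ := by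
      change (⟨(s.transformMarked (⟨I, [], n⟩ : MarkedIdeal Y)).ideal.comap V₁.ι, [], n⟩ : MarkedIdeal _) =
        ⟨I.comap f₁, [], n⟩
      rw [hKey]
    -- extend over the closed `s.comp ⁻¹' (T' ∖ T) ⊆ V₁`
    have hS₁V : s.comp ⁻¹' (T' \ T) ⊆ Set.range V₁.ι := by
      rintro x ⟨-, hxT⟩
      rw [Scheme.Opens.range_ι]
      exact hxT
    have hu_over₁ : (s'.restrict f₁).CentresOver (V₁.ι ⁻¹' (s.comp ⁻¹' (T' \ T))) := by
      refine CentreSeq.CentresOver.mono _ ?_ hu_over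
      rintro v (hv : f₁ v ∈ T')
      exact ⟨hv, hf₁T v⟩
    have hu_adm₁ : WeakAdmissible (s'.restrict f₁)
        ((⟨(s.transformMarked (⟨I, [], n⟩ : MarkedIdeal Y)).ideal, [], n⟩ : MarkedIdeal s.top).comap V₁.ι) := by
      rw [hM]; exact hu_adm
    obtain ⟨t, ht_adm, ht_over, hpb⟩ := exists_extend_weak (s'.restrict f₁) V₁.ι
      (⟨(s.transformMarked (⟨I, [], n⟩ : MarkedIdeal Y)).ideal, [], n⟩ : MarkedIdeal s.top)
      (s.comp ⁻¹' (T' \ T)) hS₁cl hS₁V hu_adm₁ hu_over₁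
    have hTt : Scheme.IsRegular t.top := isRegular_top_of_weakAdmissible t _ hY₁ ht_adm
    refine ⟨t, ht_adm, ht_over, hTt, ?_⟩
    refine tauTwo_of_isPullbackAlong V₁.ι t (s'.restrict f₁) hpb _ hS₁V hTu hTt ?_
    intro x₀ hx₀ hox₀
    rw [hM] at hox₀ ⊢
    exact hτu x₀ hx₀.1 hox₀

/-- **Transport of the port's conclusion along an identification of tops** (`CentreSeq.top_append` is a
propositional equality of schemes; `CentreSeq.comp_append` / `CentreSeq.transformMarked_append` relate the composites
and transforms through `eqToHom` / `HEq`): the predicate «regular, order `≤ n`, every top point of class `≥ 2` for the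
composite `k`-structure» passes along such an identification.  Pure bookkeeping (`subst`). [folklore] -/
theorem transport_conclusion {k : Type} [Field k] {Y : Scheme.{0}} (g : Y ⟶ Spec (.of k)) (n : ℕ) :
    ∀ {Y₁ Y₂ : Scheme.{0}} (e : Y₁ = Y₂) (f₁ : Y₁ ⟶ Y) (f₂ : Y₂ ⟶ Y) (M₁ : MarkedIdeal Y₁) (M₂ : MarkedIdeal Y₂),
      f₁ = eqToHom e ≫ f₂ → HEq M₁ M₂ →
      (∃ hT : Scheme.IsRegular Y₂, (∀ x : Y₂, idealOrder M₂.ideal x ≤ ((n : ℕ) : ℕ∞)) ∧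
        ∀ x : Y₂, idealOrder M₂.ideal x = ((n : ℕ) : ℕ∞) → ClassGE (f₂ ≫ g) hT M₂.ideal n 2 x) →
      ∃ hT : Scheme.IsRegular Y₁, (∀ x : Y₁, idealOrder M₁.ideal x ≤ ((n : ℕ) : ℕ∞)) ∧
        ∀ x : Y₁, idealOrder M₁.ideal x = ((n : ℕ) : ℕ∞) → ClassGE (f₁ ≫ g) hT M₁.ideal n 2 x
  | _, _, rfl, f₁, f₂, M₁, M₂, hf, hM, h => by
    obtain rfl : M₁ = M₂ := eq_of_heq hM
    obtain rfl : f₁ = f₂ := by simpa using hf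
    exact h

/-- **THE PORT KERNEL = the typed residual `ExitCut.MultiUnitPackageTransport` with FINITELY MANY UNITS (induction on
their number).**  In the frame (dim-`≤ 4` regular `k`-variety, order `≤ n`) with finitely many package units `F` such
that every top point is of class `≥ 2` or lies on a unit of `F`, there is a weakly admissible sequence with regular
top after which the order is still `≤ n` and EVERY top point is of class `≥ 2` for the composite `k`-structure.
Step: run the package `s` of one unit `u₀ ∈ F` (its top is again a dim-`≤ 4` regular `k`-variety:
`CentreSeq.isProper_comp`, `CentreSeq.topologicalKrullDim_top_le`, `isRegular_top_of_weakAdmissible`; order `≤ n`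
persists: `idealOrder_transformMarked_le`); over `u₀` every top point has `τ ≥ 2` (the package), off `u₀` class `≥ 2`
and the other units are transported (`classGE_of_isIso_stalkMap`, `exists_unit_transport`; the transported units,
indexed by `F ∖ {u₀}`, are fewer); the induction hypothesis handles the transformed datum and the two sequences are
concatenated (`ExitCut.weakAdmissible_append_iff`, `transport_conclusion` over `CentreSeq.top_append` /
`comp_append` / `transformMarked_append`, `ForcedTowerClasses.weakAdmissible_congr`).  Base (`F = ∅`): the empty
sequence. [folklore] -/
theorem transport_kernel (n : ℕ) : ∀ (m : ℕ) (p : ℕ), p.Prime →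
    ∀ (k : Type) [Field k] [CharP k p] (Y : Scheme.{0}) (g : Y ⟶ Spec (.of k))
    [IsSeparated g] [LocallyOfFiniteType g] [QuasiCompact g] (hY : Scheme.IsRegular Y),
    topologicalKrullDim Y ≤ 4 →
    ∀ I : Y.IdealSheafData, (∀ y : Y, idealOrder I y ≤ ((n : ℕ) : ℕ∞)) →
    ∀ F : Finset (PackageUnit I n), F.card ≤ m →
      (∀ y : Y, idealOrder I y = ((n : ℕ) : ℕ∞) → ClassGE g hY I n 2 y ∨ ∃ u ∈ F, y ∈ u.carrier) →
      ∃ t : CentreSeq Y, WeakAdmissible t (⟨I, [], n⟩ : MarkedIdeal Y) ∧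
        ∃ hT : Scheme.IsRegular t.top,
          (∀ x : t.top, idealOrder (t.transformMarked (⟨I, [], n⟩ : MarkedIdeal Y)).ideal x ≤ ((n : ℕ) : ℕ∞)) ∧
          ∀ x : t.top, idealOrder (t.transformMarked (⟨I, [], n⟩ : MarkedIdeal Y)).ideal x = ((n : ℕ) : ℕ∞) →
            ClassGE (t.comp ≫ g) hT (t.transformMarked (⟨I, [], n⟩ : MarkedIdeal Y)).ideal n 2 x := by
  intro m
  induction m with
  | zero =>
    intro p hp k _ _ Y g _ _ _ hY h4 I hord F hF hcov
    have hF0 : F = ∅ := Finset.card_eq_zero.mp (Nat.le_zero.mp hF)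
    subst hF0
    refine ⟨.nil Y, trivial, hY, hord, fun y hy => ?_⟩
    rcases hcov y hy with hc | ⟨u, hu, -⟩
    · simpa using hc
    · simp at hu
  | succ m ih =>
    intro p hp k _ _ Y g _ _ _ hY h4 I hord F hF hcov
    classical
    by_cases hFe : F = ∅
    · subst hFe
      exact ih p hp k Y g hY h4 I hord ∅ (by simp) hcov
    obtain ⟨u₀, hu₀F⟩ := Finset.nonempty_iff_ne_empty.mpr hFe
    obtain ⟨U, hTU, hUT⟩ := u₀.openInTop
    haveI : IsLocallyNoetherian Y := LocallyOfFiniteType.isLocallyNoetherian g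
    obtain ⟨s, hadm, hover, hreg, hτ⟩ := u₀.exits inferInstance
    haveI : IsProper s.comp := s.isProper_comp
    haveI : IsLocallyNoetherian s.top := LocallyOfFiniteType.isLocallyNoetherian s.comp
    have h4₁ : topologicalKrullDim s.top ≤ 4 := by
      have := CentreSeq.topologicalKrullDim_top_le s (N := 4) (by exact_mod_cast h4)
      exact_mod_cast this
    have hord₁ : ∀ x : s.top,
        idealOrder (s.transformMarked (⟨I, [], n⟩ : MarkedIdeal Y)).ideal x ≤ ((n : ℕ) : ℕ∞) :=
      idealOrder_transformMarked_le s _ hY hadm hord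
    -- the transported units
    choose tr htr using fun u : PackageUnit I n =>
      exists_unit_transport hY I n s hadm hover u₀.isClosed hTU hUT u
    let F₁ : Finset (PackageUnit (s.transformMarked (⟨I, [], n⟩ : MarkedIdeal Y)).ideal n) :=
      (F.erase u₀).image tr
    have hF₁ : F₁.card ≤ m := by
      refine Finset.card_image_le.trans ?_
      rw [Finset.card_erase_of_mem hu₀F]
      omega
    have hcov₁ : ∀ x : s.top,
        idealOrder (s.transformMarked (⟨I, [], n⟩ : MarkedIdeal Y)).ideal x = ((n : ℕ) : ℕ∞) →
        ClassGE (s.comp ≫ g) hreg (s.transformMarked (⟨I, [], n⟩ : MarkedIdeal Y)).ideal n 2 x ∨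
          ∃ u₁ ∈ F₁, x ∈ u₁.carrier := by
      intro x hx
      by_cases hxT : s.comp x ∈ u₀.carrier
      · exact Or.inl (Or.inr (Or.inr ⟨by norm_num, hτ x hxT hx⟩))
      · haveI := hover.isIso_stalkMap_comp_of_not_mem u₀.isClosed hxT
        have hst := stalkIdeal_transformMarked_eq_map_of_not_mem s (⟨I, [], n⟩ : MarkedIdeal Y) hover x hxT
        have hox : idealOrder I (s.comp x) = ((n : ℕ) : ℕ∞) := by
          rw [← idealOrder_eq_of_isIso_stalkMap s.comp I _ hst]; exact hx
        rcases hcov (s.comp x) hox with hc | ⟨u, huF, hxu⟩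
        · exact Or.inl (classGE_of_isIso_stalkMap g s.comp hY hreg I _ n 2 hst hc)
        · have hne : u ≠ u₀ := fun h => hxT (h ▸ hxu)
          refine Or.inr ⟨tr u, Finset.mem_image.mpr ⟨u, Finset.mem_erase.mpr ⟨hne, huF⟩, rfl⟩, ?_⟩
          rw [htr u]
          exact ⟨hxu, hxT⟩
    obtain ⟨t₁, ht₁adm, hT₁, hord₂, hcls₂⟩ := ih p hp k s.top (s.comp ≫ g) hreg h4₁ _ hord₁ F₁ hF₁ hcov₁
    -- concatenate: `s ⧺ t₁`
    have hcongr := ForcedTowerClasses.weakAdmissible_congr t₁ (s.transformMarked (⟨I, [], n⟩ : MarkedIdeal Y))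
      ⟨(s.transformMarked (⟨I, [], n⟩ : MarkedIdeal Y)).ideal, [], n⟩ rfl (CentreSeq.transformMarked_mult s _)
    refine ⟨s.append t₁, (ExitCut.weakAdmissible_append_iff s t₁ _).mpr ⟨hadm, hcongr.1.mpr ht₁adm⟩, ?_⟩
    refine transport_conclusion g n (CentreSeq.top_append s t₁) (s.append t₁).comp (t₁.comp ≫ s.comp)
      ((s.append t₁).transformMarked (⟨I, [], n⟩ : MarkedIdeal Y))
      (t₁.transformMarked (s.transformMarked (⟨I, [], n⟩ : MarkedIdeal Y)))
      (CentreSeq.comp_append s t₁) (CentreSeq.transformMarked_append s t₁ _) ⟨hT₁, fun x => ?_, fun x hx => ?_⟩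
    · rw [hcongr.2.1]; exact hord₂ x
    · rw [hcongr.2.1] at hx ⊢
      rw [Category.assoc]
      exact hcls₂ x hx

end Port

end Summit.ResolutionOfSingularities.ResolutionOfSingularities.Theorems.PortCut
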